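import Summits.KontsevichZagierPeriods.KontsevichZagierPeriods.Theses.TerasomaMultiplication
import Summits.KontsevichZagierPeriods.KontsevichZagierPeriods.Theorems.TerasomaMultiplicationMultiplicationAccessibleCornerGlue
import Summits.KontsevichZagierPeriods.KontsevichZagierPeriods.Theorems.TerasomaMultiplicationMultiplicationAccessibleTranslateX
import Literature.NumberTheory.Transcendental.KZProductIdeal
import Literature.NumberTheory.Transcendental.KZLogCalculusProofs
import Literature.NumberTheory.Transcendental.SemialgebraicLineDeriv

/-!
# `MultiplicationAccessible` (stmt-KontsevichZagierPeriods-12305), line `shifted-family-prime-sieve`: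
assembly of the corner Stokes in dimension `p = n + 2` ⇒ `GM(m; x, s)` for every `m` ⇒ both crux stubs

General-`p` version of `CornerThree` (design `GeneralPDesign.md`): the `n + 1` lateral Newton–Leibniz moves
`N_{θ_i} ∼ 0` (`cornerThetaGen`), the exceptional-face move `N_y ∼ −R` (`cornerYGen`), the `v`-move
`N_v ∼ [U, GD]` (`cornerVGen`), the structural closedness (`cornerClosedGen`), the graph package, the blow-up
chart and the rotation average give the corner identity `(♣)_p` for `x ≥ 2, s ≥ 3`; `gm_of_corner_at` and the
Beta translations give `GM(m; x, s)` for all `m ≥ 0` and all `x, s > 0`, hence `stub_gmThreeShifted` (`m = 2`)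
and `stub_oddPrimeShiftedFrom5` (`m = p − 1`).
-/

noncomputable section

open MeasureTheory Set Real Finset
open scoped BigOperators
open Literature.NumberTheory.Transcendental
open Literature.NumberTheory.Transcendental.KZ

namespace Summit.KontsevichZagierPeriods.TerasomaMultiplication.MultiplicationAccessible

-- ===== TEMPORARY local copies of the registered general-p sub-goals (replace by imports when landed) =====
/-- registered general-p sub-goal `cornerThetaGen` (temporary local copy). -/
theorem cornerThetaGen : ∀ (n : ℕ) (x s : ℚ), 2 ≤ x → 3 ≤ s → ∀ (Θ T : (Fin (n + 2) → ℝ) → Fin (n + 2) → ℝ) (Z S H K : (Fin (n + 2) → ℝ) → ℝ)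
      (M : (Fin (n + 2) → ℝ) → Fin (n + 2) → ℝ) (P : (Fin (n + 3) → ℝ) → ℝ),
    (∀ u, Θ u 0 = 1 - ∑ i : Fin (n + 1), u (Fin.castSucc i)) → (∀ u (i : Fin (n + 1)), Θ u i.succ = u (Fin.castSucc i)) →
    (∀ u k, T u k = 1 - u (Fin.last (n + 1)) * Θ u k) →
    (∀ u, Z u = (∏ k, T u k) ^ (1 / ((n:ℝ) + 2))) →
    (∀ u, S u = ∑ j ∈ Finset.range (n + 2), (-1:ℝ) ^ j * u (Fin.last (n + 1)) ^ j *
      ∑ A ∈ Finset.powersetCard (j + 1) (Finset.univ : Finset (Fin (n + 2))), ∏ k ∈ A, Θ u k) →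
    (∀ u, H u = (∑ j ∈ Finset.range (n + 2), Z u ^ j) / S u) →
    (∀ u, K u = (∏ k, Θ u k) ^ ((s:ℝ) - 1)) →
    (∀ u k, M u k = (T u k) ^ (x:ℝ) * ∏ j : Fin (n + 1), (T u (k + j.succ)) ^ ((x:ℝ) + (((j:ℕ):ℝ) + 1) / ((n:ℝ) + 2) - 1)) →
    (∀ w, P w = (w (Fin.last (n + 2))) ^ (((n:ℝ) + 2) * (x:ℝ) - 1) *
      (1 - w (Fin.last (n + 2)) * Z (Fin.init w)) ^ (((n:ℝ) + 2) * (s:ℝ) - 1) * H (Fin.init w) ^ (((n:ℝ) + 2) * (s:ℝ)) * K (Fin.init w)) →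
    ∀ (Vθ : Fin (n + 1) → (Fin (n + 3) → ℝ) → ℝ), (∀ (i : Fin (n + 1)) w, Vθ i w = P w * (Fin.init w : Fin (n + 2) → ℝ) (Fin.castSucc i) *
      (∑ j, Θ (Fin.init w) j * (M (Fin.init w) i.succ - M (Fin.init w) j)) / (Fin.init w : Fin (n + 2) → ℝ) (Fin.last (n + 1))) →
    ∀ i : Fin (n + 1), ∃ N : KZ.IntegralRep (n + 3), N.domain = {w : Fin (n + 3) → ℝ | (Fin.init w : Fin (n + 2) → ℝ) ∈ {u : Fin (n + 2) → ℝ | (∀ i : Fin (n + 1), 0 < u (Fin.castSucc i)) ∧ ∑ i : Fin (n + 1), u (Fin.castSucc i) < 1 ∧ 0 < u (Fin.last (n + 1)) ∧ u (Fin.last (n + 1)) * (1 - ∑ i : Fin (n + 1), u (Fin.castSucc i)) < 1 ∧ ∀ i : Fin (n + 1), u (Fin.last (n + 1)) * u (Fin.castSucc i) < 1} ∧ 0 < w (Fin.last (n + 2)) ∧ w (Fin.last (n + 2)) < 1} ∧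
      (∀ w ∈ N.domain, HasDerivAt (fun a => Vθ i (Function.update w (Fin.castSucc (Fin.castSucc i) : Fin (n + 3)) a)) (N.integrand w) (w (Fin.castSucc (Fin.castSucc i) : Fin (n + 3)))) ∧
      KZ.of N ∈ KZ.relations := by
  sorry

/-- registered general-p sub-goal `cornerYGen` (temporary local copy). -/
theorem cornerYGen : ∀ (n : ℕ) (x s : ℚ), 2 ≤ x → 3 ≤ s → ∀ (Θ T : (Fin (n + 2) → ℝ) → Fin (n + 2) → ℝ) (Z S H K : (Fin (n + 2) → ℝ) → ℝ)
      (M : (Fin (n + 2) → ℝ) → Fin (n + 2) → ℝ) (P : (Fin (n + 3) → ℝ) → ℝ),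
    (∀ u, Θ u 0 = 1 - ∑ i : Fin (n + 1), u (Fin.castSucc i)) → (∀ u (i : Fin (n + 1)), Θ u i.succ = u (Fin.castSucc i)) →
    (∀ u k, T u k = 1 - u (Fin.last (n + 1)) * Θ u k) →
    (∀ u, Z u = (∏ k, T u k) ^ (1 / ((n:ℝ) + 2))) →
    (∀ u, S u = ∑ j ∈ Finset.range (n + 2), (-1:ℝ) ^ j * u (Fin.last (n + 1)) ^ j *
      ∑ A ∈ Finset.powersetCard (j + 1) (Finset.univ : Finset (Fin (n + 2))), ∏ k ∈ A, Θ u k) →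
    (∀ u, H u = (∑ j ∈ Finset.range (n + 2), Z u ^ j) / S u) →
    (∀ u, K u = (∏ k, Θ u k) ^ ((s:ℝ) - 1)) →
    (∀ u k, M u k = (T u k) ^ (x:ℝ) * ∏ j : Fin (n + 1), (T u (k + j.succ)) ^ ((x:ℝ) + (((j:ℕ):ℝ) + 1) / ((n:ℝ) + 2) - 1)) →
    (∀ w, P w = (w (Fin.last (n + 2))) ^ (((n:ℝ) + 2) * (x:ℝ) - 1) *
      (1 - w (Fin.last (n + 2)) * Z (Fin.init w)) ^ (((n:ℝ) + 2) * (s:ℝ) - 1) * H (Fin.init w) ^ (((n:ℝ) + 2) * (s:ℝ)) * K (Fin.init w)) →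
    ∀ (Vy : (Fin (n + 3) → ℝ) → ℝ), (∀ w, Vy w = P w * ∑ k, Θ (Fin.init w) k * M (Fin.init w) k) →
    ∀ (R : KZ.IntegralRep (n + 2)), R.domain = {q : Fin (n + 2) → ℝ | (∀ i : Fin (n + 1), 0 < q (Fin.castSucc i)) ∧ ∑ i : Fin (n + 1), q (Fin.castSucc i) < 1 ∧ 0 < q (Fin.last (n + 1)) ∧ q (Fin.last (n + 1)) < 1} →
    Set.EqOn R.integrand (fun q => (((n:ℝ) + 2) * (q (Fin.last (n + 1))) ^ (((n:ℝ) + 2) * (x:ℝ) - 1) * (1 - q (Fin.last (n + 1))) ^ (((n:ℝ) + 2) * (s:ℝ) - 1)) *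
      (((n:ℝ) + 2) ^ (((n:ℝ) + 2) * (s:ℝ) - 1) * ((1 - ∑ i : Fin (n + 1), q (Fin.castSucc i)) * ∏ i : Fin (n + 1), q (Fin.castSucc i)) ^ ((s:ℝ) - 1))) R.domain →
    ∃ N : KZ.IntegralRep (n + 3), N.domain = {w : Fin (n + 3) → ℝ | (Fin.init w : Fin (n + 2) → ℝ) ∈ {u : Fin (n + 2) → ℝ | (∀ i : Fin (n + 1), 0 < u (Fin.castSucc i)) ∧ ∑ i : Fin (n + 1), u (Fin.castSucc i) < 1 ∧ 0 < u (Fin.last (n + 1)) ∧ u (Fin.last (n + 1)) * (1 - ∑ i : Fin (n + 1), u (Fin.castSucc i)) < 1 ∧ ∀ i : Fin (n + 1), u (Fin.last (n + 1)) * u (Fin.castSucc i) < 1} ∧ 0 < w (Fin.last (n + 2)) ∧ w (Fin.last (n + 2)) < 1} ∧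
      (∀ w ∈ N.domain, HasDerivAt (fun a => Vy (Function.update w (Fin.castSucc (Fin.last (n + 1)) : Fin (n + 3)) a)) (N.integrand w) (w (Fin.castSucc (Fin.last (n + 1)) : Fin (n + 3)))) ∧
      KZ.of N + KZ.of R ∈ KZ.relations := by
  sorry

/-- registered general-p sub-goal `cornerClosedGen` (temporary local copy). -/
theorem cornerClosedGen : ∀ (n : ℕ) (x s : ℚ), 2 ≤ x → 3 ≤ s → ∀ (Θ T : (Fin (n + 2) → ℝ) → Fin (n + 2) → ℝ) (Z S H K : (Fin (n + 2) → ℝ) → ℝ)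
      (M : (Fin (n + 2) → ℝ) → Fin (n + 2) → ℝ) (P : (Fin (n + 3) → ℝ) → ℝ),
    (∀ u, Θ u 0 = 1 - ∑ i : Fin (n + 1), u (Fin.castSucc i)) → (∀ u (i : Fin (n + 1)), Θ u i.succ = u (Fin.castSucc i)) →
    (∀ u k, T u k = 1 - u (Fin.last (n + 1)) * Θ u k) →
    (∀ u, Z u = (∏ k, T u k) ^ (1 / ((n:ℝ) + 2))) →
    (∀ u, S u = ∑ j ∈ Finset.range (n + 2), (-1:ℝ) ^ j * u (Fin.last (n + 1)) ^ j *
      ∑ A ∈ Finset.powersetCard (j + 1) (Finset.univ : Finset (Fin (n + 2))), ∏ k ∈ A, Θ u k) →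
    (∀ u, H u = (∑ j ∈ Finset.range (n + 2), Z u ^ j) / S u) →
    (∀ u, K u = (∏ k, Θ u k) ^ ((s:ℝ) - 1)) →
    (∀ u k, M u k = (T u k) ^ (x:ℝ) * ∏ j : Fin (n + 1), (T u (k + j.succ)) ^ ((x:ℝ) + (((j:ℕ):ℝ) + 1) / ((n:ℝ) + 2) - 1)) →
    (∀ w, P w = (w (Fin.last (n + 2))) ^ (((n:ℝ) + 2) * (x:ℝ) - 1) *
      (1 - w (Fin.last (n + 2)) * Z (Fin.init w)) ^ (((n:ℝ) + 2) * (s:ℝ) - 1) * H (Fin.init w) ^ (((n:ℝ) + 2) * (s:ℝ)) * K (Fin.init w)) →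
    ∀ (Vθ : Fin (n + 1) → (Fin (n + 3) → ℝ) → ℝ) (Vy Vv : (Fin (n + 3) → ℝ) → ℝ), (∀ (i : Fin (n + 1)) w, Vθ i w = P w * (Fin.init w : Fin (n + 2) → ℝ) (Fin.castSucc i) *
      (∑ j, Θ (Fin.init w) j * (M (Fin.init w) i.succ - M (Fin.init w) j)) / (Fin.init w : Fin (n + 2) → ℝ) (Fin.last (n + 1))) →
    (∀ w, Vy w = P w * ∑ k, Θ (Fin.init w) k * M (Fin.init w) k) →
    (∀ w, Vv w = -(1 / ((n:ℝ) + 2) * (w (Fin.last (n + 2))) ^ (((n:ℝ) + 2) * (x:ℝ)) *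
      (1 - w (Fin.last (n + 2)) * Z (Fin.init w)) ^ (((n:ℝ) + 2) * (s:ℝ) - 1) * H (Fin.init w) ^ (((n:ℝ) + 2) * (s:ℝ) - 1) *
      K (Fin.init w) * ∑ k, M (Fin.init w) k / T (Fin.init w) k)) →
    ∀ w ∈ {w : Fin (n + 3) → ℝ | (Fin.init w : Fin (n + 2) → ℝ) ∈ {u : Fin (n + 2) → ℝ | (∀ i : Fin (n + 1), 0 < u (Fin.castSucc i)) ∧ ∑ i : Fin (n + 1), u (Fin.castSucc i) < 1 ∧ 0 < u (Fin.last (n + 1)) ∧ u (Fin.last (n + 1)) * (1 - ∑ i : Fin (n + 1), u (Fin.castSucc i)) < 1 ∧ ∀ i : Fin (n + 1), u (Fin.last (n + 1)) * u (Fin.castSucc i) < 1} ∧ 0 < w (Fin.last (n + 2)) ∧ w (Fin.last (n + 2)) < 1}, ∀ (dθ : Fin (n + 1) → ℝ) (dy dv : ℝ),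
      (∀ i, HasDerivAt (fun a => Vθ i (Function.update w (Fin.castSucc (Fin.castSucc i) : Fin (n + 3)) a)) (dθ i) (w (Fin.castSucc (Fin.castSucc i) : Fin (n + 3)))) →
      HasDerivAt (fun a => Vy (Function.update w (Fin.castSucc (Fin.last (n + 1)) : Fin (n + 3)) a)) dy (w (Fin.castSucc (Fin.last (n + 1)) : Fin (n + 3))) →
      HasDerivAt (fun a => Vv (Function.update w (Fin.last (n + 2)) a)) dv (w (Fin.last (n + 2))) →
      ∑ i, dθ i + dy - dv = 0 := by
  sorry

/-- registered general-p sub-goal `cornerGraphDerivGen` (temporary local copy). -/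
theorem cornerGraphDerivGen : ∀ (n : ℕ) (x s : ℚ), 2 ≤ x → 3 ≤ s → ∀ (Θ T : (Fin (n + 2) → ℝ) → Fin (n + 2) → ℝ) (Z S H K : (Fin (n + 2) → ℝ) → ℝ)
      (M : (Fin (n + 2) → ℝ) → Fin (n + 2) → ℝ) (P : (Fin (n + 3) → ℝ) → ℝ),
    (∀ u, Θ u 0 = 1 - ∑ i : Fin (n + 1), u (Fin.castSucc i)) → (∀ u (i : Fin (n + 1)), Θ u i.succ = u (Fin.castSucc i)) →
    (∀ u k, T u k = 1 - u (Fin.last (n + 1)) * Θ u k) →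
    (∀ u, Z u = (∏ k, T u k) ^ (1 / ((n:ℝ) + 2))) →
    (∀ u, S u = ∑ j ∈ Finset.range (n + 2), (-1:ℝ) ^ j * u (Fin.last (n + 1)) ^ j *
      ∑ A ∈ Finset.powersetCard (j + 1) (Finset.univ : Finset (Fin (n + 2))), ∏ k ∈ A, Θ u k) →
    (∀ u, H u = (∑ j ∈ Finset.range (n + 2), Z u ^ j) / S u) →
    (∀ u, K u = (∏ k, Θ u k) ^ ((s:ℝ) - 1)) →
    (∀ u k, M u k = (T u k) ^ (x:ℝ) * ∏ j : Fin (n + 1), (T u (k + j.succ)) ^ ((x:ℝ) + (((j:ℕ):ℝ) + 1) / ((n:ℝ) + 2) - 1)) →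
    (∀ w, P w = (w (Fin.last (n + 2))) ^ (((n:ℝ) + 2) * (x:ℝ) - 1) *
      (1 - w (Fin.last (n + 2)) * Z (Fin.init w)) ^ (((n:ℝ) + 2) * (s:ℝ) - 1) * H (Fin.init w) ^ (((n:ℝ) + 2) * (s:ℝ)) * K (Fin.init w)) →
    ∀ (G : (Fin (n + 2) → ℝ) → ℝ), (∀ t : Fin (n + 2) → ℝ, G t = (∑ j : Fin (n + 2), (∏ i ∈ Finset.univ.filter (fun i : Fin (n + 2) => i < j), t i) /
        ((∏ k, t k) ^ (1 / ((n:ℝ) + 2))) ^ (j:ℕ)) / ((n:ℝ) + 2) *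
      ∏ k : Fin (n + 2), (t k) ^ ((x:ℝ) + ((k:ℕ):ℝ) / ((n:ℝ) + 2) - 1) * (1 - t k) ^ ((s:ℝ) - 1)) →
    ∀ (Vv : (Fin (n + 3) → ℝ) → ℝ), (∀ w, Vv w = -(1 / ((n:ℝ) + 2) * (w (Fin.last (n + 2))) ^ (((n:ℝ) + 2) * (x:ℝ)) *
      (1 - w (Fin.last (n + 2)) * Z (Fin.init w)) ^ (((n:ℝ) + 2) * (s:ℝ) - 1) * H (Fin.init w) ^ (((n:ℝ) + 2) * (s:ℝ) - 1) *
      K (Fin.init w) * ∑ k, M (Fin.init w) k / T (Fin.init w) k)) →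
    ∀ w ∈ {w : Fin (n + 3) → ℝ | (Fin.init w : Fin (n + 2) → ℝ) ∈ {u : Fin (n + 2) → ℝ | (∀ i : Fin (n + 1), 0 < u (Fin.castSucc i)) ∧ ∑ i : Fin (n + 1), u (Fin.castSucc i) < 1 ∧ 0 < u (Fin.last (n + 1)) ∧ u (Fin.last (n + 1)) * (1 - ∑ i : Fin (n + 1), u (Fin.castSucc i)) < 1 ∧ ∀ i : Fin (n + 1), u (Fin.last (n + 1)) * u (Fin.castSucc i) < 1} ∧ 0 < w (Fin.last (n + 2)) ∧ w (Fin.last (n + 2)) < 1},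
      HasDerivAt (fun a => Vv (Function.update w (Fin.last (n + 2)) a))
        (-((((n:ℝ) + 2) * (x:ℝ) * (w (Fin.last (n + 2))) ^ (((n:ℝ) + 2) * (x:ℝ) - 1) *
            ((1 - w (Fin.last (n + 2)) * Z (Fin.init w)) / (1 - Z (Fin.init w))) ^ (((n:ℝ) + 2) * (s:ℝ) - 1) -
          (((n:ℝ) + 2) * (s:ℝ) - 1) * (w (Fin.last (n + 2))) ^ (((n:ℝ) + 2) * (x:ℝ)) * Z (Fin.init w) *
            ((1 - w (Fin.last (n + 2)) * Z (Fin.init w)) / (1 - Z (Fin.init w))) ^ (((n:ℝ) + 2) * (s:ℝ) - 2) / (1 - Z (Fin.init w))) *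
          (G (T (Fin.init w)) * ((Fin.init w : Fin (n + 2) → ℝ) (Fin.last (n + 1))) ^ (n + 1)))) (w (Fin.last (n + 2))) := by
  sorry

/-- registered general-p sub-goal `cornerGraphRepsGen` (temporary local copy). -/
theorem cornerGraphRepsGen : ∀ (n : ℕ) (x s : ℚ), 2 ≤ x → 3 ≤ s → ∀ (Θ T : (Fin (n + 2) → ℝ) → Fin (n + 2) → ℝ) (Z S H K : (Fin (n + 2) → ℝ) → ℝ)
      (M : (Fin (n + 2) → ℝ) → Fin (n + 2) → ℝ) (P : (Fin (n + 3) → ℝ) → ℝ),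
    (∀ u, Θ u 0 = 1 - ∑ i : Fin (n + 1), u (Fin.castSucc i)) → (∀ u (i : Fin (n + 1)), Θ u i.succ = u (Fin.castSucc i)) →
    (∀ u k, T u k = 1 - u (Fin.last (n + 1)) * Θ u k) →
    (∀ u, Z u = (∏ k, T u k) ^ (1 / ((n:ℝ) + 2))) →
    (∀ u, S u = ∑ j ∈ Finset.range (n + 2), (-1:ℝ) ^ j * u (Fin.last (n + 1)) ^ j *
      ∑ A ∈ Finset.powersetCard (j + 1) (Finset.univ : Finset (Fin (n + 2))), ∏ k ∈ A, Θ u k) →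
    (∀ u, H u = (∑ j ∈ Finset.range (n + 2), Z u ^ j) / S u) →
    (∀ u, K u = (∏ k, Θ u k) ^ ((s:ℝ) - 1)) →
    (∀ u k, M u k = (T u k) ^ (x:ℝ) * ∏ j : Fin (n + 1), (T u (k + j.succ)) ^ ((x:ℝ) + (((j:ℕ):ℝ) + 1) / ((n:ℝ) + 2) - 1)) →
    (∀ w, P w = (w (Fin.last (n + 2))) ^ (((n:ℝ) + 2) * (x:ℝ) - 1) *
      (1 - w (Fin.last (n + 2)) * Z (Fin.init w)) ^ (((n:ℝ) + 2) * (s:ℝ) - 1) * H (Fin.init w) ^ (((n:ℝ) + 2) * (s:ℝ)) * K (Fin.init w)) →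
    ∀ (G : (Fin (n + 2) → ℝ) → ℝ), (∀ t : Fin (n + 2) → ℝ, G t = (∑ j : Fin (n + 2), (∏ i ∈ Finset.univ.filter (fun i : Fin (n + 2) => i < j), t i) /
        ((∏ k, t k) ^ (1 / ((n:ℝ) + 2))) ^ (j:ℕ)) / ((n:ℝ) + 2) *
      ∏ k : Fin (n + 2), (t k) ^ ((x:ℝ) + ((k:ℕ):ℝ) / ((n:ℝ) + 2) - 1) * (1 - t k) ^ ((s:ℝ) - 1)) →
    (∃ r₀ : KZ.IntegralRep (n + 2), r₀.domain = {t : Fin (n + 2) → ℝ | ∀ k, t k ∈ Set.Ioo (0:ℝ) 1} ∧ r₀.integrand = G) ∧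
    (∃ rU : KZ.IntegralRep (n + 2), rU.domain = {u : Fin (n + 2) → ℝ | (∀ i : Fin (n + 1), 0 < u (Fin.castSucc i)) ∧ ∑ i : Fin (n + 1), u (Fin.castSucc i) < 1 ∧ 0 < u (Fin.last (n + 1)) ∧ u (Fin.last (n + 1)) * (1 - ∑ i : Fin (n + 1), u (Fin.castSucc i)) < 1 ∧ ∀ i : Fin (n + 1), u (Fin.last (n + 1)) * u (Fin.castSucc i) < 1} ∧
      rU.integrand = fun u => G (T u) * (u (Fin.last (n + 1))) ^ (n + 1)) ∧
    (∃ C : ℝ, ∀ u ∈ {u : Fin (n + 2) → ℝ | (∀ i : Fin (n + 1), 0 < u (Fin.castSucc i)) ∧ ∑ i : Fin (n + 1), u (Fin.castSucc i) < 1 ∧ 0 < u (Fin.last (n + 1)) ∧ u (Fin.last (n + 1)) * (1 - ∑ i : Fin (n + 1), u (Fin.castSucc i)) < 1 ∧ ∀ i : Fin (n + 1), u (Fin.last (n + 1)) * u (Fin.castSucc i) < 1},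
      |G (T u) * (u (Fin.last (n + 1))) ^ (n + 1)| ≤ C * (1 - Z u) ^ (((n:ℝ) + 2) * (s:ℝ) - 1)) := by
  sorry

/-- registered general-p sub-goal `cornerVGen` (temporary local copy). -/
theorem cornerVGen : ∀ (n : ℕ) (x s : ℚ), 1 ≤ x → 1 ≤ s → ∀ (Θ T : (Fin (n + 2) → ℝ) → Fin (n + 2) → ℝ) (Z GD : (Fin (n + 2) → ℝ) → ℝ) (C : ℝ),
    (∀ u, Θ u 0 = 1 - ∑ i : Fin (n + 1), u (Fin.castSucc i)) → (∀ u (i : Fin (n + 1)), Θ u i.succ = u (Fin.castSucc i)) →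
    (∀ u k, T u k = 1 - u (Fin.last (n + 1)) * Θ u k) →
    (∀ u, Z u = (∏ k, T u k) ^ (1 / ((n:ℝ) + 2))) →
    (∀ u ∈ {u : Fin (n + 2) → ℝ | (∀ i : Fin (n + 1), 0 < u (Fin.castSucc i)) ∧ ∑ i : Fin (n + 1), u (Fin.castSucc i) < 1 ∧ 0 < u (Fin.last (n + 1)) ∧ u (Fin.last (n + 1)) * (1 - ∑ i : Fin (n + 1), u (Fin.castSucc i)) < 1 ∧ ∀ i : Fin (n + 1), u (Fin.last (n + 1)) * u (Fin.castSucc i) < 1}, |GD u| ≤ C * (1 - Z u) ^ (((n:ℝ) + 2) * (s:ℝ) - 1)) →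
    ∀ (rU : KZ.IntegralRep (n + 2)), rU.domain = {u : Fin (n + 2) → ℝ | (∀ i : Fin (n + 1), 0 < u (Fin.castSucc i)) ∧ ∑ i : Fin (n + 1), u (Fin.castSucc i) < 1 ∧ 0 < u (Fin.last (n + 1)) ∧ u (Fin.last (n + 1)) * (1 - ∑ i : Fin (n + 1), u (Fin.castSucc i)) < 1 ∧ ∀ i : Fin (n + 1), u (Fin.last (n + 1)) * u (Fin.castSucc i) < 1} → Set.EqOn rU.integrand GD rU.domain →
    ∃ N : KZ.IntegralRep (n + 3), N.domain = {w : Fin (n + 3) → ℝ | (Fin.init w : Fin (n + 2) → ℝ) ∈ {u : Fin (n + 2) → ℝ | (∀ i : Fin (n + 1), 0 < u (Fin.castSucc i)) ∧ ∑ i : Fin (n + 1), u (Fin.castSucc i) < 1 ∧ 0 < u (Fin.last (n + 1)) ∧ u (Fin.last (n + 1)) * (1 - ∑ i : Fin (n + 1), u (Fin.castSucc i)) < 1 ∧ ∀ i : Fin (n + 1), u (Fin.last (n + 1)) * u (Fin.castSucc i) < 1} ∧ 0 < w (Fin.last (n + 2)) ∧ w (Fin.last (n + 2)) < 1} ∧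
      (N.integrand = fun w => (((n:ℝ) + 2) * (x:ℝ) * (w (Fin.last (n + 2))) ^ (((n:ℝ) + 2) * (x:ℝ) - 1) *
          ((1 - w (Fin.last (n + 2)) * Z (Fin.init w)) / (1 - Z (Fin.init w))) ^ (((n:ℝ) + 2) * (s:ℝ) - 1) -
        (((n:ℝ) + 2) * (s:ℝ) - 1) * (w (Fin.last (n + 2))) ^ (((n:ℝ) + 2) * (x:ℝ)) * Z (Fin.init w) *
          ((1 - w (Fin.last (n + 2)) * Z (Fin.init w)) / (1 - Z (Fin.init w))) ^ (((n:ℝ) + 2) * (s:ℝ) - 2) / (1 - Z (Fin.init w))) *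
        GD (Fin.init w)) ∧
      KZ.Equivalent N rU := by
  sorry

/-- registered general-p sub-goal `blowupChartGen` (temporary local copy). -/
theorem blowupChartGen : ∀ (n : ℕ) (x s : ℚ), 0 < x → 0 < s → ∀ (Θ T : (Fin (n + 2) → ℝ) → Fin (n + 2) → ℝ),
    (∀ u, Θ u 0 = 1 - ∑ i : Fin (n + 1), u (Fin.castSucc i)) → (∀ u (i : Fin (n + 1)), Θ u i.succ = u (Fin.castSucc i)) →
    (∀ u k, T u k = 1 - u (Fin.last (n + 1)) * Θ u k) →
    ∀ (G : (Fin (n + 2) → ℝ) → ℝ), (∀ t : Fin (n + 2) → ℝ, G t = (∑ j : Fin (n + 2), (∏ i ∈ Finset.univ.filter (fun i : Fin (n + 2) => i < j), t i) /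
        ((∏ k, t k) ^ (1 / ((n:ℝ) + 2))) ^ (j:ℕ)) / ((n:ℝ) + 2) *
      ∏ k : Fin (n + 2), (t k) ^ ((x:ℝ) + ((k:ℕ):ℝ) / ((n:ℝ) + 2) - 1) * (1 - t k) ^ ((s:ℝ) - 1)) →
    ∀ (rU r₀ : KZ.IntegralRep (n + 2)), rU.domain = {u : Fin (n + 2) → ℝ | (∀ i : Fin (n + 1), 0 < u (Fin.castSucc i)) ∧ ∑ i : Fin (n + 1), u (Fin.castSucc i) < 1 ∧ 0 < u (Fin.last (n + 1)) ∧ u (Fin.last (n + 1)) * (1 - ∑ i : Fin (n + 1), u (Fin.castSucc i)) < 1 ∧ ∀ i : Fin (n + 1), u (Fin.last (n + 1)) * u (Fin.castSucc i) < 1} →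
    Set.EqOn rU.integrand (fun u => G (T u) * (u (Fin.last (n + 1))) ^ (n + 1)) rU.domain →
    r₀.domain = {t : Fin (n + 2) → ℝ | ∀ k, t k ∈ Set.Ioo (0:ℝ) 1} → Set.EqOn r₀.integrand G r₀.domain → KZ.Equivalent rU r₀ := by
  sorry

/-- registered general-p sub-goal `rotationAverageGen` (temporary local copy). -/
theorem rotationAverageGen : ∀ (n : ℕ) (x s : ℚ), 0 < x → 0 < s → ∀ (G : (Fin (n + 2) → ℝ) → ℝ), (∀ t : Fin (n + 2) → ℝ, G t = (∑ j : Fin (n + 2), (∏ i ∈ Finset.univ.filter (fun i : Fin (n + 2) => i < j), t i) /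
        ((∏ k, t k) ^ (1 / ((n:ℝ) + 2))) ^ (j:ℕ)) / ((n:ℝ) + 2) *
      ∏ k : Fin (n + 2), (t k) ^ ((x:ℝ) + ((k:ℕ):ℝ) / ((n:ℝ) + 2) - 1) * (1 - t k) ^ ((s:ℝ) - 1)) →
    ∀ (r r₀ : KZ.IntegralRep (n + 2)), r.domain = {t : Fin (n + 2) → ℝ | ∀ k, t k ∈ Set.Ioo (0:ℝ) 1} →
    Set.EqOn r.integrand (fun t => ∏ k : Fin (n + 2), (t k) ^ ((x:ℝ) + ((k:ℕ):ℝ) / ((n:ℝ) + 2) - 1) * (1 - t k) ^ ((s:ℝ) - 1)) r.domain →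
    r₀.domain = {t : Fin (n + 2) → ℝ | ∀ k, t k ∈ Set.Ioo (0:ℝ) 1} → Set.EqOn r₀.integrand G r₀.domain → KZ.Equivalent r r₀ := by
  sorry

/-- registered general-p sub-goal `gm_of_gm_succ_s` (temporary local copy). -/
theorem gm_of_gm_succ_s : ∀ (m : ℕ) (x s : ℚ), 0 < x → 0 < s → (∀ (r r' : KZ.IntegralRep (m + 1)), r.domain = {z | ∀ i, z i ∈ Set.Ioo (0:ℝ) 1} → Set.EqOn r.integrand (fun z => ∏ k : Fin (m + 1), (z k) ^ (((x:ℝ)) + ((k:ℕ):ℝ) / ((m:ℝ) + 1) - 1) * (1 - z k) ^ (((((s + 1 : ℚ)):ℝ)) - 1)) r.domain → r'.domain = {z | ∀ i, z i ∈ Set.Ioo (0:ℝ) 1} → Set.EqOn r'.integrand (fun z => ((m:ℝ) + 1) ^ (((m:ℝ) + 1) * ((((s + 1 : ℚ)):ℝ))) * ((z 0) ^ (((m:ℝ) + 1) * ((x:ℝ)) - 1) * (1 - z 0) ^ (((m:ℝ) + 1) * ((((s + 1 : ℚ)):ℝ)) - 1)) * ∏ j : Fin m, (z j.succ) ^ ((((j:ℕ):ℝ)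 + 1) * ((((s + 1 : ℚ)):ℝ)) - 1) * (1 - z j.succ) ^ (((((s + 1 : ℚ)):ℝ)) - 1)) r'.domain → KZ.Equivalent r r') →
    ∀ (r r' : KZ.IntegralRep (m + 1)), r.domain = {z | ∀ i, z i ∈ Set.Ioo (0:ℝ) 1} → Set.EqOn r.integrand (fun z => ∏ k : Fin (m + 1), (z k) ^ (((x:ℝ)) + ((k:ℕ):ℝ) / ((m:ℝ) + 1) - 1) * (1 - z k) ^ (((s:ℝ)) - 1)) r.domain → r'.domain = {z | ∀ i, z i ∈ Set.Ioo (0:ℝ) 1} → Set.EqOn r'.integrand (fun z => ((m:ℝ) + 1) ^ (((m:ℝ) + 1) * ((s:ℝ))) * ((z 0) ^ (((m:ℝ) + 1) * ((x:ℝ)) - 1) * (1 - z 0) ^ (((m:ℝ) + 1) * ((s:ℝ)) - 1)) * ∏ j : Fin m, (z j.succ) ^ ((((j:ℕ):ℝ) + 1) * ((s:ℝ)) - 1) * (1 - z j.succ) ^ (((s:ℝ)) - 1)) r'.domain → KZ.Equivalent r r' := by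
  sorry

-- ===== end temporary block =====

namespace CornerGen

variable {d : ℕ}

/-- Pointwise difference of two representations on a common domain, with the additivity relation.
[cite: KontsevichZagier2001, §1.2 rule (1)] -/
theorem exists_sub_rel (A B : IntegralRep d) (h : B.domain = A.domain) :
    ∃ T : IntegralRep d, T.domain = A.domain ∧ (T.integrand = fun z => A.integrand z - B.integrand z) ∧
      of A - of T - of B ∈ relations := by
  have hB : IsSemialgebraicFunOn ℚ A.domain B.integrand := h ▸ B.isSemialgebraicFunOn_integrand
  have hBi : IntegrableOn B.integrand A.domain := h ▸ B.integrableOn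
  let T : IntegralRep d := ⟨A.domain, fun z => A.integrand z - B.integrand z, A.isSemialgebraic_domain,
    IsSemialgebraicFunOn.sub_holds A.isSemialgebraicFunOn_integrand hB, A.integrableOn.sub hBi⟩
  refine ⟨T, rfl, rfl, integrandAddRel_subset_relations ⟨d, A, T, B, rfl, h, fun z _ => ?_, rfl⟩⟩
  simp [T]

/-- Pointwise sum of two representations on a common domain, with the additivity relation.
[cite: KontsevichZagier2001, §1.2 rule (1)] -/
theorem exists_add_rel (A B : IntegralRep d) (h : B.domain = A.domain) :
    ∃ T : IntegralRep d, T.domain = A.domain ∧ (T.integrand = fun z => A.integrand z + B.integrand z) ∧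
      of T - of A - of B ∈ relations := by
  have hB : IsSemialgebraicFunOn ℚ A.domain B.integrand := h ▸ B.isSemialgebraicFunOn_integrand
  have hBi : IntegrableOn B.integrand A.domain := h ▸ B.integrableOn
  let T : IntegralRep d := ⟨A.domain, fun z => A.integrand z + B.integrand z, A.isSemialgebraic_domain,
    IsSemialgebraicFunOn.add_holds A.isSemialgebraicFunOn_integrand hB, A.integrableOn.add hBi⟩
  refine ⟨T, rfl, rfl, integrandAddRel_subset_relations ⟨d, T, A, B, rfl, h, fun z _ => ?_, rfl⟩⟩
  simp [T]

/-- Finite pointwise sums of representations on a common domain exist and differ from the formal sum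
by a relation. [cite: KontsevichZagier2001, §1.2 rule (1)] -/
theorem exists_sum_rel (A : IntegralRep d) : ∀ (k : ℕ) (N : Fin k → IntegralRep d), (∀ i, (N i).domain = A.domain) →
    ∃ T : IntegralRep d, T.domain = A.domain ∧ (T.integrand = fun z => ∑ i, (N i).integrand z) ∧
      of T - ∑ i, of (N i) ∈ relations := by
  intro k
  induction k with
  | zero =>
    intro N _
    let T : IntegralRep d := ⟨A.domain, fun _ => 0, A.isSemialgebraic_domain,
      by simpa using isSemialgebraicFunOn_ratCast A.isSemialgebraic_domain 0, integrableOn_zero⟩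
    refine ⟨T, rfl, ?_, ?_⟩
    · funext z; simp [T]
    · simp only [Finset.univ_eq_empty, Finset.sum_empty, sub_zero]
      exact of_mem_relations_of_eqOn_zero T fun z _ => rfl
  | succ k ih =>
    intro N hN
    obtain ⟨T, hTd, hTi, hTrel⟩ := ih (fun i => N i.castSucc) fun i => hN i.castSucc
    obtain ⟨T', hT'd, hT'i, hT'rel⟩ := exists_add_rel T (N (Fin.last k)) ((hN _).trans hTd.symm)
    refine ⟨T', hT'd.trans hTd, ?_, ?_⟩
    · rw [hT'i]; funext z; rw [Fin.sum_univ_castSucc, hTi]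
    · rw [Fin.sum_univ_castSucc]
      have : of T' - (∑ i : Fin k, of (N i.castSucc) + of (N (Fin.last k))) =
          (of T' - of T - of (N (Fin.last k))) + (of T - ∑ i : Fin k, of (N i.castSucc)) := by abel
      rw [this]
      exact relations.add_mem hT'rel hTrel

/-- **Stokes bookkeeping** (general): representations `N_i`, `A`, `B` on a common domain whose integrands
satisfy `Σ_i N_i + A + B ≡ 0` give `Σ_i [N_i] + [A] + [B] ∈ relations`. [cite: KontsevichZagier2001, §1.2 rule (1)] -/
theorem of_sum_mem {k : ℕ} (N : Fin k → IntegralRep d) (A B : IntegralRep d)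
    (hN : ∀ i, (N i).domain = A.domain) (hB : B.domain = A.domain)
    (h0 : ∀ z ∈ A.domain, ∑ i, (N i).integrand z + A.integrand z + B.integrand z = 0) :
    ∑ i, of (N i) + of A + of B ∈ relations := by
  obtain ⟨T, hTd, hTi, hTrel⟩ := exists_sum_rel A k N hN
  obtain ⟨T₂, hT₂d, hT₂i, b⟩ := exists_add_rel T A hTd.symm
  obtain ⟨T₃, hT₃d, hT₃i, c⟩ := exists_add_rel T₂ B (hB.trans (hT₂d.trans hTd).symm)
  have hz : of T₃ ∈ relations := by
    refine of_mem_relations_of_eqOn_zero T₃ fun z hz => ?_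
    rw [hT₃d, hT₂d, hTd] at hz
    simp only [hT₃i, hT₂i, hTi, Pi.zero_apply]
    exact h0 z hz
  have : ∑ i, of (N i) + of A + of B = -(of T - ∑ i, of (N i)) - (of T₂ - of T - of A) -
      (of T₃ - of T₂ - of B) + of T₃ := by abel
  rw [this]
  exact relations.add_mem (relations.sub_mem (relations.sub_mem (relations.neg_mem hTrel) b) c) hz

end CornerGen

/-- **The Stokes core in dimension `p = n + 2`** (abstract atoms): closedness + the `n + 3` Newton–Leibniz
moves give `[U, GD] ∼ R` (graph density versus exceptional face). [cite: KontsevichZagier2001, §1.2] -/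
theorem stokes_core_gen : ∀ (n : ℕ) (x s : ℚ), 2 ≤ x → 3 ≤ s → ∀ (Θ T : (Fin (n + 2) → ℝ) → Fin (n + 2) → ℝ) (Z S H K : (Fin (n + 2) → ℝ) → ℝ)
      (M : (Fin (n + 2) → ℝ) → Fin (n + 2) → ℝ) (P : (Fin (n + 3) → ℝ) → ℝ),
    (∀ u, Θ u 0 = 1 - ∑ i : Fin (n + 1), u (Fin.castSucc i)) → (∀ u (i : Fin (n + 1)), Θ u i.succ = u (Fin.castSucc i)) →
    (∀ u k, T u k = 1 - u (Fin.last (n + 1)) * Θ u k) →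
    (∀ u, Z u = (∏ k, T u k) ^ (1 / ((n:ℝ) + 2))) →
    (∀ u, S u = ∑ j ∈ Finset.range (n + 2), (-1:ℝ) ^ j * u (Fin.last (n + 1)) ^ j *
      ∑ A ∈ Finset.powersetCard (j + 1) (Finset.univ : Finset (Fin (n + 2))), ∏ k ∈ A, Θ u k) →
    (∀ u, H u = (∑ j ∈ Finset.range (n + 2), Z u ^ j) / S u) →
    (∀ u, K u = (∏ k, Θ u k) ^ ((s:ℝ) - 1)) →
    (∀ u k, M u k = (T u k) ^ (x:ℝ) * ∏ j : Fin (n + 1), (T u (k + j.succ)) ^ ((x:ℝ) + (((j:ℕ):ℝ) + 1) / ((n:ℝ) + 2) - 1)) →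
    (∀ w, P w = (w (Fin.last (n + 2))) ^ (((n:ℝ) + 2) * (x:ℝ) - 1) *
      (1 - w (Fin.last (n + 2)) * Z (Fin.init w)) ^ (((n:ℝ) + 2) * (s:ℝ) - 1) * H (Fin.init w) ^ (((n:ℝ) + 2) * (s:ℝ)) * K (Fin.init w)) →
    ∀ (G : (Fin (n + 2) → ℝ) → ℝ), (∀ t : Fin (n + 2) → ℝ, G t = (∑ j : Fin (n + 2), (∏ i ∈ Finset.univ.filter (fun i : Fin (n + 2) => i < j), t i) /
        ((∏ k, t k) ^ (1 / ((n:ℝ) + 2))) ^ (j:ℕ)) / ((n:ℝ) + 2) *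
      ∏ k : Fin (n + 2), (t k) ^ ((x:ℝ) + ((k:ℕ):ℝ) / ((n:ℝ) + 2) - 1) * (1 - t k) ^ ((s:ℝ) - 1)) →
    ∀ (C : ℝ), (∀ u ∈ {u : Fin (n + 2) → ℝ | (∀ i : Fin (n + 1), 0 < u (Fin.castSucc i)) ∧ ∑ i : Fin (n + 1), u (Fin.castSucc i) < 1 ∧ 0 < u (Fin.last (n + 1)) ∧ u (Fin.last (n + 1)) * (1 - ∑ i : Fin (n + 1), u (Fin.castSucc i)) < 1 ∧ ∀ i : Fin (n + 1), u (Fin.last (n + 1)) * u (Fin.castSucc i) < 1}, |G (T u) * (u (Fin.last (n + 1))) ^ (n + 1)| ≤ C * (1 - Z u) ^ (((n:ℝ) + 2) * (s:ℝ) - 1)) →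
    ∀ (rU : IntegralRep (n + 2)), rU.domain = {u : Fin (n + 2) → ℝ | (∀ i : Fin (n + 1), 0 < u (Fin.castSucc i)) ∧ ∑ i : Fin (n + 1), u (Fin.castSucc i) < 1 ∧ 0 < u (Fin.last (n + 1)) ∧ u (Fin.last (n + 1)) * (1 - ∑ i : Fin (n + 1), u (Fin.castSucc i)) < 1 ∧ ∀ i : Fin (n + 1), u (Fin.last (n + 1)) * u (Fin.castSucc i) < 1} →
    (rU.integrand = fun u => G (T u) * (u (Fin.last (n + 1))) ^ (n + 1)) →
    ∀ (R : IntegralRep (n + 2)), R.domain = {q : Fin (n + 2) → ℝ | (∀ i : Fin (n + 1), 0 < q (Fin.castSucc i)) ∧ ∑ i : Fin (n + 1), q (Fin.castSucc i) < 1 ∧ 0 < q (Fin.last (n + 1)) ∧ q (Fin.last (n + 1)) < 1} →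
    Set.EqOn R.integrand (fun q => (((n:ℝ) + 2) * (q (Fin.last (n + 1))) ^ (((n:ℝ) + 2) * (x:ℝ) - 1) * (1 - q (Fin.last (n + 1))) ^ (((n:ℝ) + 2) * (s:ℝ) - 1)) *
      (((n:ℝ) + 2) ^ (((n:ℝ) + 2) * (s:ℝ) - 1) * ((1 - ∑ i : Fin (n + 1), q (Fin.castSucc i)) * ∏ i : Fin (n + 1), q (Fin.castSucc i)) ^ ((s:ℝ) - 1))) R.domain →
    Equivalent rU R := by
  intro n x s hx hs Θ T Z S H K M P hΘ0 hΘs hT hZ hS hH hK hM hP G hG C hC rU hrUd hrUi R hRd hRi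
  have hx1 : (1:ℚ) ≤ x := by linarith
  have hs1 : (1:ℚ) ≤ s := by linarith
  -- the components (as lambdas over the abstract atoms)
  set Vθ : Fin (n + 1) → (Fin (n + 3) → ℝ) → ℝ := fun i w => P w * (Fin.init w : Fin (n + 2) → ℝ) (Fin.castSucc i) *
      (∑ j, Θ (Fin.init w) j * (M (Fin.init w) i.succ - M (Fin.init w) j)) /
      (Fin.init w : Fin (n + 2) → ℝ) (Fin.last (n + 1)) with hVθ
  set Vy : (Fin (n + 3) → ℝ) → ℝ := fun w => P w * ∑ k, Θ (Fin.init w) k * M (Fin.init w) k with hVy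
  set Vv : (Fin (n + 3) → ℝ) → ℝ := fun w => -(1 / ((n:ℝ) + 2) * (w (Fin.last (n + 2))) ^ (((n:ℝ) + 2) * (x:ℝ)) *
      (1 - w (Fin.last (n + 2)) * Z (Fin.init w)) ^ (((n:ℝ) + 2) * (s:ℝ) - 1) * H (Fin.init w) ^ (((n:ℝ) + 2) * (s:ℝ) - 1) *
      K (Fin.init w) * ∑ k, M (Fin.init w) k / T (Fin.init w) k) with hVv
  -- the lateral moves, the face move, the v-move
  have hθN := cornerThetaGen n x s hx hs Θ T Z S H K M P hΘ0 hΘs hT hZ hS hH hK hM hP Vθ (fun _ _ => rfl)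
  choose Nθ hNθd hNθder hNθrel using hθN
  obtain ⟨Ny, hNyd, hNyder, hNyrel⟩ :=
    cornerYGen n x s hx hs Θ T Z S H K M P hΘ0 hΘs hT hZ hS hH hK hM hP Vy (fun _ => rfl) R hRd hRi
  obtain ⟨Nv, hNvd, hNvi, hNveq⟩ := cornerVGen n x s hx1 hs1 Θ T Z (fun u => G (T u) * (u (Fin.last (n + 1))) ^ (n + 1)) C
    hΘ0 hΘs hT hZ hC rU hrUd (by rw [hrUi]; exact fun _ _ => rfl)
  -- closedness on `W`
  have hsum : ∀ w ∈ Ny.domain, ∑ i, (Nθ i).integrand w + Ny.integrand w + Nv.integrand w = 0 := by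
    intro w hw
    have hw' : w ∈ {w : Fin (n + 3) → ℝ | (Fin.init w : Fin (n + 2) → ℝ) ∈ {u : Fin (n + 2) → ℝ | (∀ i : Fin (n + 1), 0 < u (Fin.castSucc i)) ∧ ∑ i : Fin (n + 1), u (Fin.castSucc i) < 1 ∧ 0 < u (Fin.last (n + 1)) ∧ u (Fin.last (n + 1)) * (1 - ∑ i : Fin (n + 1), u (Fin.castSucc i)) < 1 ∧ ∀ i : Fin (n + 1), u (Fin.last (n + 1)) * u (Fin.castSucc i) < 1} ∧ 0 < w (Fin.last (n + 2)) ∧ w (Fin.last (n + 2)) < 1} := by rw [hNyd] at hw; exact hw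
    have hθ : ∀ i, HasDerivAt (fun a => Vθ i (Function.update w (Fin.castSucc (Fin.castSucc i) : Fin (n + 3)) a))
        ((Nθ i).integrand w) (w (Fin.castSucc (Fin.castSucc i) : Fin (n + 3))) :=
      fun i => hNθder i w (by rw [hNθd]; exact hw')
    have hy := hNyder w hw
    have hv : HasDerivAt (fun a => Vv (Function.update w (Fin.last (n + 2)) a)) (-(Nv.integrand w))
        (w (Fin.last (n + 2))) := by
      have hd := cornerGraphDerivGen n x s hx hs Θ T Z S H K M P hΘ0 hΘs hT hZ hS hH hK hM hP G hG Vv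
        (fun _ => rfl) w hw'
      convert hd using 2
      rw [hNvi]
    have hc := cornerClosedGen n x s hx hs Θ T Z S H K M P hΘ0 hΘs hT hZ hS hH hK hM hP Vθ Vy Vv
      (fun _ _ => rfl) (fun _ => rfl) (fun _ => rfl) w hw' _ _ _ hθ hy hv
    linarith
  have key := CornerGen.of_sum_mem Nθ Ny Nv (fun i => (hNθd i).trans hNyd.symm) (hNvd.trans hNyd.symm) hsum
  have hθrel : ∑ i, of (Nθ i) ∈ relations := sum_mem fun i _ => hNθrel i
  show of rU - of R ∈ relations
  have : of rU - of R = (∑ i, of (Nθ i) + of Ny + of Nv) - ∑ i, of (Nθ i) - (of Ny + of R) - (of Nv - of rU) := by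
    abel
  rw [this]
  exact relations.sub_mem (relations.sub_mem (relations.sub_mem key hθrel) hNyrel) hNveq


/-- Relabelling of the Beta × Dirichlet representation to the order `(θ₁, …, θ_{n+1}, v)`: domain. [folklore] -/
theorem CornerGen.reindex_domain_eq {n : ℕ} (r' : IntegralRep (n + 1 + 1))
    (hr'd : r'.domain = {w | w 0 ∈ Set.Ioo (0:ℝ) 1 ∧ (∀ i : Fin (n + 1), 0 < w i.succ) ∧ ∑ i : Fin (n + 1), w i.succ < 1}) :
    (r'.reindex (finRotate (n + 2)).symm).domain = {q : Fin (n + 2) → ℝ | (∀ i : Fin (n + 1), 0 < q (Fin.castSucc i)) ∧ ∑ i : Fin (n + 1), q (Fin.castSucc i) < 1 ∧ 0 < q (Fin.last (n + 1)) ∧ q (Fin.last (n + 1)) < 1} := by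
  have he0 : (finRotate (n + 2)).symm 0 = Fin.last (n + 1) := (Equiv.symm_apply_eq _).mpr finRotate_last.symm
  have hes : ∀ i : Fin (n + 1), (finRotate (n + 2)).symm i.succ = Fin.castSucc i := by
    intro i
    rw [Equiv.symm_apply_eq]
    exact Fin.ext (by rw [coe_finRotate_of_ne_last (Fin.castSucc_lt_last i).ne]; simp)
  ext q
  simp only [IntegralRep.reindex_domain, hr'd, mem_setOf_eq, he0, hes, Set.mem_Ioo]
  tauto

/-- Relabelling of the Beta × Dirichlet representation: integrand = the exceptional-face density
`p·v^(px−1)(1−v)^(ps−1)·p^(ps−1)·(θ₀θ₁⋯θ_{n+1})^(s−1)`. [folklore] -/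
theorem CornerGen.reindex_integrand_eqOn {n : ℕ} (x s : ℚ) (r' : IntegralRep (n + 1 + 1))
    (hr'd : r'.domain = {w | w 0 ∈ Set.Ioo (0:ℝ) 1 ∧ (∀ i : Fin (n + 1), 0 < w i.succ) ∧ ∑ i : Fin (n + 1), w i.succ < 1})
    (hr'i : Set.EqOn r'.integrand (fun w => (((n + 1 : ℕ):ℝ) + 1) * ((w 0) ^ ((((n + 1 : ℕ):ℝ) + 1) * (x:ℝ) - 1) *
      (1 - w 0) ^ ((((n + 1 : ℕ):ℝ) + 1) * (s:ℝ) - 1)) * ((((n + 1 : ℕ):ℝ) + 1) ^ ((((n + 1 : ℕ):ℝ) + 1) * (s:ℝ) - 1) *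
      ((∏ i : Fin (n + 1), (w i.succ) ^ ((s:ℝ) - 1)) * (1 - ∑ i : Fin (n + 1), w i.succ) ^ ((s:ℝ) - 1)))) r'.domain) :
    Set.EqOn (r'.reindex (finRotate (n + 2)).symm).integrand (fun q => (((n:ℝ) + 2) * (q (Fin.last (n + 1))) ^ (((n:ℝ) + 2) * (x:ℝ) - 1) * (1 - q (Fin.last (n + 1))) ^ (((n:ℝ) + 2) * (s:ℝ) - 1)) *
      (((n:ℝ) + 2) ^ (((n:ℝ) + 2) * (s:ℝ) - 1) * ((1 - ∑ i : Fin (n + 1), q (Fin.castSucc i)) * ∏ i : Fin (n + 1), q (Fin.castSucc i)) ^ ((s:ℝ) - 1))) (r'.reindex (finRotate (n + 2)).symm).domain := by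
  have he0 : (finRotate (n + 2)).symm 0 = Fin.last (n + 1) := (Equiv.symm_apply_eq _).mpr finRotate_last.symm
  have hes : ∀ i : Fin (n + 1), (finRotate (n + 2)).symm i.succ = Fin.castSucc i := by
    intro i
    rw [Equiv.symm_apply_eq]
    exact Fin.ext (by rw [coe_finRotate_of_ne_last (Fin.castSucc_lt_last i).ne]; simp)
  intro q hq
  have hq' : (fun i => q ((finRotate (n + 2)).symm i)) ∈ r'.domain := hq
  have hpos : (∀ i : Fin (n + 1), 0 < q (Fin.castSucc i)) ∧ ∑ i : Fin (n + 1), q (Fin.castSucc i) < 1 := by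
    rw [hr'd] at hq'
    simp only [mem_setOf_eq, hes] at hq'
    exact ⟨hq'.2.1, hq'.2.2⟩
  simp only [IntegralRep.reindex_integrand]
  rw [hr'i hq']
  simp only [he0, hes]
  have hP : (((n + 1 : ℕ):ℝ) + 1) = ((n:ℝ) + 2) := by push_cast; ring
  rw [hP, Real.mul_rpow (by linarith [hpos.2]) (Finset.prod_nonneg fun i _ => (hpos.1 i).le),
    Real.finsetProd_rpow _ _ (fun i _ => (hpos.1 i).le)]
  ring_nf

/-- **`(♣)_p` for `x ≥ 2`, `s ≥ 3`** (`p = n + 2`): the shifted `p`-fold Beta product is equivalent to the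
corner (Beta × Dirichlet) representation — rotation average, blow-up chart, the Stokes core, relabelling.
[cite: KontsevichZagier2001, §1.2] -/
theorem cornerGen : ∀ (n : ℕ) (x s : ℚ), 2 ≤ x → 3 ≤ s → ∀ (r r' : KZ.IntegralRep (n + 1 + 1)), r.domain = {z | ∀ i, z i ∈ Set.Ioo (0:ℝ) 1} → Set.EqOn r.integrand (fun z => ∏ k : Fin (n + 1 + 1), (z k) ^ ((x:ℝ) + ((k:ℕ):ℝ) / (((n + 1 : ℕ):ℝ) + 1) - 1) * (1 - z k) ^ ((s:ℝ) - 1)) r.domain → r'.domain = {w | w 0 ∈ Set.Ioo (0:ℝ) 1 ∧ (∀ i : Fin (n + 1), 0 < w i.succ) ∧ ∑ i : Fin (n + 1), w i.succ < 1} → Set.EqOn r'.integrand (fun w => (((n + 1 : ℕ):ℝ) + 1) * ((w 0) ^ ((((n + 1 : ℕ):ℝ) + 1) * (x:ℝ) - 1) * (1 - w 0) ^ ((((n + 1 : ℕ):ℝ) + 1) * (s:ℝ) - 1)) * ((((n + 1 : ℕ):ℝ) + 1) ^ ((((n + 1 : ℕ):ℝ) + 1) * (s:ℝ) - 1) * ((∏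 i : Fin (n + 1), (w i.succ) ^ ((s:ℝ) - 1)) * (1 - ∑ i : Fin (n + 1), w i.succ) ^ ((s:ℝ) - 1)))) r'.domain → KZ.Equivalent r r' := by
  intro n x s hx hs r r' hrd hri hr'd hr'i
  have hx0 : (0:ℚ) < x := by linarith
  have hs0 : (0:ℚ) < s := by linarith
  -- the atoms, instantiated
  set Θ : (Fin (n + 2) → ℝ) → Fin (n + 2) → ℝ :=
    fun u k => Fin.cases (1 - ∑ i : Fin (n + 1), u (Fin.castSucc i)) (fun i => u (Fin.castSucc i)) k with hΘdef
  have hΘ0 : ∀ u, Θ u 0 = 1 - ∑ i : Fin (n + 1), u (Fin.castSucc i) := fun _ => rfl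
  have hΘs : ∀ u (i : Fin (n + 1)), Θ u i.succ = u (Fin.castSucc i) := fun _ _ => rfl
  set T : (Fin (n + 2) → ℝ) → Fin (n + 2) → ℝ := fun u k => 1 - u (Fin.last (n + 1)) * Θ u k with hTdef
  set Z : (Fin (n + 2) → ℝ) → ℝ := fun u => (∏ k, T u k) ^ (1 / ((n:ℝ) + 2)) with hZdef
  set S : (Fin (n + 2) → ℝ) → ℝ := fun u => ∑ j ∈ Finset.range (n + 2), (-1:ℝ) ^ j * u (Fin.last (n + 1)) ^ j *
      ∑ A ∈ Finset.powersetCard (j + 1) (Finset.univ : Finset (Fin (n + 2))), ∏ k ∈ A, Θ u k with hSdef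
  set H : (Fin (n + 2) → ℝ) → ℝ := fun u => (∑ j ∈ Finset.range (n + 2), Z u ^ j) / S u with hHdef
  set K : (Fin (n + 2) → ℝ) → ℝ := fun u => (∏ k, Θ u k) ^ ((s:ℝ) - 1) with hKdef
  set M : (Fin (n + 2) → ℝ) → Fin (n + 2) → ℝ := fun u k => (T u k) ^ (x:ℝ) *
      ∏ j : Fin (n + 1), (T u (k + j.succ)) ^ ((x:ℝ) + (((j:ℕ):ℝ) + 1) / ((n:ℝ) + 2) - 1) with hMdef
  set P : (Fin (n + 3) → ℝ) → ℝ := fun w => (w (Fin.last (n + 2))) ^ (((n:ℝ) + 2) * (x:ℝ) - 1) *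
      (1 - w (Fin.last (n + 2)) * Z (Fin.init w)) ^ (((n:ℝ) + 2) * (s:ℝ) - 1) * H (Fin.init w) ^ (((n:ℝ) + 2) * (s:ℝ)) *
      K (Fin.init w) with hPdef
  set G : (Fin (n + 2) → ℝ) → ℝ := fun t => (∑ j : Fin (n + 2), (∏ i ∈ Finset.univ.filter (fun i : Fin (n + 2) => i < j), t i) /
        ((∏ k, t k) ^ (1 / ((n:ℝ) + 2))) ^ (j:ℕ)) / ((n:ℝ) + 2) *
      ∏ k : Fin (n + 2), (t k) ^ ((x:ℝ) + ((k:ℕ):ℝ) / ((n:ℝ) + 2) - 1) * (1 - t k) ^ ((s:ℝ) - 1) with hGdef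
  have hG : (∀ t : Fin (n + 2) → ℝ, G t = (∑ j : Fin (n + 2), (∏ i ∈ Finset.univ.filter (fun i : Fin (n + 2) => i < j), t i) /
        ((∏ k, t k) ^ (1 / ((n:ℝ) + 2))) ^ (j:ℕ)) / ((n:ℝ) + 2) *
      ∏ k : Fin (n + 2), (t k) ^ ((x:ℝ) + ((k:ℕ):ℝ) / ((n:ℝ) + 2) - 1) * (1 - t k) ^ ((s:ℝ) - 1)) := fun _ => rfl
  obtain ⟨⟨r₀, hr₀d, hr₀i⟩, ⟨rU, hrUd, hrUi⟩, ⟨C, hC⟩⟩ :=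
    cornerGraphRepsGen n x s hx hs Θ T Z S H K M P hΘ0 hΘs (fun _ _ => rfl) (fun _ => rfl) (fun _ => rfl)
      (fun _ => rfl) (fun _ => rfl) (fun _ _ => rfl) (fun _ => rfl) G hG
  have hP' : (((n + 1 : ℕ):ℝ) + 1) = ((n:ℝ) + 2) := by push_cast; ring
  have hri' : Set.EqOn r.integrand
      (fun t => ∏ k : Fin (n + 2), (t k) ^ ((x:ℝ) + ((k:ℕ):ℝ) / ((n:ℝ) + 2) - 1) * (1 - t k) ^ ((s:ℝ) - 1)) r.domain := by
    intro t ht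
    rw [hri ht]
    simp only [hP']
  have e1 : Equivalent r r₀ :=
    rotationAverageGen n x s hx0 hs0 G hG r r₀ hrd hri' hr₀d (by rw [hr₀i]; exact fun _ _ => rfl)
  have e2 : Equivalent rU r₀ :=
    blowupChartGen n x s hx0 hs0 Θ T hΘ0 hΘs (fun _ _ => rfl) G hG rU r₀ hrUd (by rw [hrUi]; exact fun _ _ => rfl)
      hr₀d (by rw [hr₀i]; exact fun _ _ => rfl)
  set R := r'.reindex (finRotate (n + 2)).symm with hRdef
  have hRd := CornerGen.reindex_domain_eq r' hr'd
  have hRi := CornerGen.reindex_integrand_eqOn x s r' hr'd hr'i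
  have e3 : Equivalent rU R :=
    stokes_core_gen n x s hx hs Θ T Z S H K M P hΘ0 hΘs (fun _ _ => rfl) (fun _ => rfl) (fun _ => rfl)
      (fun _ => rfl) (fun _ => rfl) (fun _ _ => rfl) (fun _ => rfl) G hG C hC rU hrUd hrUi R hRd hRi
  have e4 : of r' - of R ∈ relations := of_sub_of_reindex_mem_relations r' (finRotate (n + 2)).symm
  show of r - of r' ∈ relations
  have : of r - of r' = (of r - of r₀) - (of rU - of r₀) + (of rU - of R) - (of r' - of R) := by abel
  rw [this]
  exact relations.sub_mem (relations.add_mem (relations.sub_mem e1 e2) e3) e4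

/-- `GM(n + 1; x, s)` for `x ≥ 2`, `s ≥ 3` (corner identity + `gm_of_corner_at`). [cite: KontsevichZagier2001, §1.2] -/
theorem gmGen_large : ∀ (n : ℕ) (x s : ℚ), 2 ≤ x → 3 ≤ s → ∀ (r r' : KZ.IntegralRep (n + 1 + 1)), r.domain = {z | ∀ i, z i ∈ Set.Ioo (0:ℝ) 1} → Set.EqOn r.integrand (fun z => ∏ k : Fin (n + 1 + 1), (z k) ^ ((x:ℝ) + ((k:ℕ):ℝ) / (((n + 1 : ℕ):ℝ) + 1) - 1) * (1 - z k) ^ ((s:ℝ) - 1)) r.domain → r'.domain = {z | ∀ i, z i ∈ Set.Ioo (0:ℝ) 1} → Set.EqOn r'.integrand (fun z => (((n + 1 : ℕ):ℝ) + 1) ^ ((((n + 1 : ℕ):ℝ) + 1) * (s:ℝ)) * ((z 0) ^ ((((n + 1 : ℕ):ℝ) + 1) * (x:ℝ) - 1) * (1 - z 0) ^ ((((n + 1 : ℕ):ℝ) + 1) * (s:ℝ) - 1)) * ∏ j : Fin (n + 1), (z j.succ) ^ ((((j:ℕ):ℝ) + 1) * (s:ℝ) - 1) * (1 - z j.succ)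 ^ ((s:ℝ) - 1)) r'.domain → KZ.Equivalent r r' := by
  intro n x s hx hs
  exact gm_of_corner_at (n + 1) x s (by linarith) (by linarith) (cornerGen n x s hx hs)

/-- **`GM(m; x, s)` for every `m ≥ 0` and all `x, s > 0`**: `m = 0` is an identity of integrands; for
`m = n + 1` reduce to `x ≥ 2`, `s ≥ 3` by the Beta translations (`gm_of_gm_succ_x` twice, `gm_of_gm_succ_s`
three times) and apply `gmGen_large`. [cite: KontsevichZagier2001, §1.2] -/
theorem gm_all : ∀ (m : ℕ) (x s : ℚ), 0 < x → 0 < s → ∀ (r r' : KZ.IntegralRep (m + 1)), r.domain = {z | ∀ i, z i ∈ Set.Ioo (0:ℝ) 1} → Set.EqOn r.integrand (fun z => ∏ k : Fin (m + 1), (z k) ^ ((x:ℝ) + ((k:ℕ):ℝ) / ((m:ℝ) + 1) - 1) * (1 - z k) ^ ((s:ℝ) - 1)) r.domain → r'.domain = {z | ∀ i, z i ∈ Set.Ioo (0:ℝ) 1} → Set.EqOn r'.integrand (fun z => ((m:ℝ) + 1) ^ (((m:ℝ) + 1) * (s:ℝ)) * ((z 0) ^ (((m:ℝ) + 1) * (x:ℝ)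 - 1) * (1 - z 0) ^ (((m:ℝ) + 1) * (s:ℝ) - 1)) * ∏ j : Fin m, (z j.succ) ^ ((((j:ℕ):ℝ) + 1) * (s:ℝ) - 1) * (1 - z j.succ) ^ ((s:ℝ) - 1)) r'.domain → KZ.Equivalent r r' := by
  intro m
  cases m with
  | zero =>
    intro x s _ _ r r' hrd hri hr'd hr'i
    refine of_sub_of_mem_relations_of_eqOn (hr'd.trans hrd.symm) fun z hz => ?_
    have hz' : z ∈ r'.domain := by rw [hr'd, ← hrd]; exact hz
    rw [hri hz, hr'i hz']
    simp only [Fin.prod_univ_succ, Fin.prod_univ_zero, Fin.val_zero, Nat.cast_zero, zero_div, add_zero,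
      zero_add, one_mul, mul_one, Real.one_rpow]
  | succ n =>
    intro x s hx hs
    have A := gmGen_large n (x + 1 + 1) (s + 1 + 1 + 1) (by linarith) (by linarith)
    have B := gm_of_gm_succ_s (n + 1) (x + 1 + 1) (s + 1 + 1) (by linarith) (by linarith) A
    have B' := gm_of_gm_succ_s (n + 1) (x + 1 + 1) (s + 1) (by linarith) (by linarith) B
    have B'' := gm_of_gm_succ_s (n + 1) (x + 1 + 1) s (by linarith) hs B'
    have D := gm_of_gm_succ_x (n + 1) (x + 1) s (by linarith) hs B''
    exact gm_of_gm_succ_x (n + 1) x s hx hs D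

/-- The crux stub `stub_gmThreeShifted` (`m = 2`). [cite: KontsevichZagier2001, §1.2] -/
theorem gmThreeShiftedGen :
    ∀ (x s : ℚ), 0 < x → 0 < s → ∀ (r r' : KZ.IntegralRep (2 + 1)),
      r.domain = {z | ∀ i, z i ∈ Set.Ioo (0:ℝ) 1} →
      Set.EqOn r.integrand (fun z => ∏ k : Fin (2 + 1),
        (z k) ^ ((x:ℝ) + ((k:ℕ):ℝ) / (((2:ℕ):ℝ) + 1) - 1) * (1 - z k) ^ ((s:ℝ) - 1)) r.domain →
      r'.domain = {z | ∀ i, z i ∈ Set.Ioo (0:ℝ) 1} →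
      Set.EqOn r'.integrand (fun z => (((2:ℕ):ℝ) + 1) ^ ((((2:ℕ):ℝ) + 1) * (s:ℝ)) *
        ((z 0) ^ ((((2:ℕ):ℝ) + 1) * (x:ℝ) - 1) * (1 - z 0) ^ ((((2:ℕ):ℝ) + 1) * (s:ℝ) - 1)) *
        ∏ j : Fin 2, (z j.succ) ^ ((((j:ℕ):ℝ) + 1) * (s:ℝ) - 1) * (1 - z j.succ) ^ ((s:ℝ) - 1))
        r'.domain →
      KZ.Equivalent r r' :=
  gm_all 2

/-- The crux stub `stub_oddPrimeShiftedFrom5` (`m = p − 1`; primality is not used). [cite: KontsevichZagier2001, §1.2] -/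
theorem oddPrimeShiftedGen :
    ∀ p : ℕ, p.Prime → 5 ≤ p →
      ∀ (x s : ℚ), 0 < x → 0 < s → ∀ (r r' : KZ.IntegralRep (p - 1 + 1)),
        r.domain = {z | ∀ i, z i ∈ Set.Ioo (0:ℝ) 1} →
        Set.EqOn r.integrand (fun z => ∏ k : Fin (p - 1 + 1),
          (z k) ^ ((x:ℝ) + ((k:ℕ):ℝ) / (((p - 1 : ℕ):ℝ) + 1) - 1) * (1 - z k) ^ ((s:ℝ) - 1))
          r.domain →
        r'.domain = {z | ∀ i, z i ∈ Set.Ioo (0:ℝ) 1} →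
        Set.EqOn r'.integrand (fun z => (((p - 1 : ℕ):ℝ) + 1) ^ ((((p - 1 : ℕ):ℝ) + 1) * (s:ℝ)) *
          ((z 0) ^ ((((p - 1 : ℕ):ℝ) + 1) * (x:ℝ) - 1) *
            (1 - z 0) ^ ((((p - 1 : ℕ):ℝ) + 1) * (s:ℝ) - 1)) *
          ∏ j : Fin (p - 1), (z j.succ) ^ ((((j:ℕ):ℝ) + 1) * (s:ℝ) - 1) *
            (1 - z j.succ) ^ ((s:ℝ) - 1)) r'.domain →
        KZ.Equivalent r r' :=
  fun p _ _ => gm_all (p - 1)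

end Summit.KontsevichZagierPeriods.TerasomaMultiplication.MultiplicationAccessible
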